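import Summits.ResolutionOfSingularities.ResolutionOfSingularities.Theorems.FrobeniusClosingPatchingRelPerfectDepthLegalTrace
import Summits.ResolutionOfSingularities.ResolutionOfSingularities.Theorems.FrobeniusClosingPatchingRelPerfectDepthFlagLegalPhases
import Literature.AlgebraicGeometry.Resolution.CanonicalResolutionSmoothCentre
import Literature.AlgebraicGeometry.Resolution.RegularLocalRingsJacobian
import HarnessLib

/-!
# Crux `PatchingRelPerfect` (stmt-ResolutionOfSingularities-16161), chain W5.2 — T6-E1b residual, `LegalPhaseTwo₃` closer (2b):
# the ENTRY `HostBoundary₃ → DepthLegal.HostState` (res-L1-w52-lead-1's STEP B spec e2551fba, item D6)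

[OURS · L1 W5.2] Fact-free; NOT statements of the manuscript under review (Hironaka 2017); AI-written, weaker than expert review.

`DepthTargets.HostBoundary₃ E H` (res-L1-w52-idea-1's phase-1 output of record, `…DepthFlagLegalPhases` p532368) packages the T5-E
transport state `WeightTwoB.StateIn H D ℬ []` (`H = D · monomialIdeal ℬ`, `D` a reduced effective Cartier host, `ℬ` an snc list of
irreducible boundary components none inside the host) together with `Scheme.IsRegular D.subscheme`.  res-L1-w52-lead-1's STEP B
state `DepthLegal.HostState H D L` (`…DepthLegalTrace` p531308) asks instead for ORDER-ONE GENERATORS of the host at its points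
(`hostHyp`).  This module is the bridge (Matsumura 14.2: for `D_x = (g)` with `g` a non-zero-divisor, `𝒪_x ⧸ (g)` regular forces
`g ∉ 𝔪_x²` — the tree's `not_isRegularLocalRing_quotient_span_singleton_of_mem_sq`, with `isRegularLocalRing_stalk_quotient_stalkIdeal`
reading the regular zero-scheme on stalks; the pattern of res-D-pv-054's `WeightTwoB.sncWithAt_singleton_of_isRegular_subscheme`):
* `HostState.of_stateIn : WeightTwoB.StateIn H D ℬ [] → Scheme.IsRegular D.subscheme → HostState H D ℬ`;
* `exists_hostState_of_hostBoundary₃` — the ∃-packaged entry with the «no host component inside the boundary» clause kept in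
  SUPPORT form (`StateIn.free`, `StateIn.irred`) and the regular zero-scheme, for the per-component loop (spec D1).

## References
* H. Matsumura, *Commutative Ring Theory* (1987), Thm. 14.2. [Matsumura1987]
* V. Cossart, U. Jannsen, S. Saito, LNM 2270 (2020), Thm. 1.4 (the setup «no component of `X` in `B`»). [CossartJannsenSaito2020]
-/

-- `Summit.<Summit>.<Sub>.Theorems` with `Sub = Summit` (single-conjunct summit, D-0017)
set_option linter.dupNamespace false

noncomputable section

open CategoryTheory CategoryTheory.Limits AlgebraicGeometry TopologicalSpace IsLocalRing
open Literature.AlgebraicGeometry.Resolution Scheme.IdealSheafData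

namespace Summit.ResolutionOfSingularities.ResolutionOfSingularities.Theorems

universe u

namespace DepthLegal

open WeightTwoB DepthTargets

variable {E : Scheme.{u}}

/-- **An effective Cartier divisor with REGULAR zero-scheme has an order-one generator at each of its points** (Matsumura 14.2:
`𝒪_x ⧸ (g)` regular ⇒ `g ∉ 𝔪_x²`). [cite: Matsumura1987, Thm. 14.2] -/
theorem exists_generator_not_mem_sq [IsLocallyNoetherian E] (hE : Scheme.IsRegular E) {D : E.IdealSheafData}
    (hD : IsEffectiveCartier D) (hreg : Scheme.IsRegular D.subscheme) {x : E} (hx : x ∈ D.support) :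
    ∃ v : E.presheaf.stalk x, stalkIdeal D x = Ideal.span {v} ∧ v ∉ (maximalIdeal (E.presheaf.stalk x)) ^ 2 := by
  haveI := hE x
  obtain ⟨g, hg0, hg⟩ := hD.exists_stalkIdeal_eq_span x
  refine ⟨g, hg, fun h2 => ?_⟩
  exact not_isRegularLocalRing_quotient_span_singleton_of_mem_sq (nonZeroDivisors.ne_zero hg0) h2
    (hg ▸ isRegularLocalRing_stalk_quotient_stalkIdeal hreg hx)

/-- [OURS · L1 W5.2] **ENTRY (spec D6): the T5-E state with a regular host IS a STEP-B host state.**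
[cite: Matsumura1987, Thm. 14.2] -/
theorem HostState.of_stateIn [IsLocallyNoetherian E] {H D : E.IdealSheafData} {ℬ : List (E.IdealSheafData × ℕ)}
    (S : WeightTwoB.StateIn H D ℬ []) (hreg : Scheme.IsRegular D.subscheme) : HostState H D ℬ where
  regE := S.regW
  fac := S.fac
  hostCartier := S.hostCartier
  hostHyp := fun _ hx => exists_generator_not_mem_sq S.regW S.hostCartier hreg hx
  sncB := S.sncB

/-- [OURS · L1 W5.2] **ENTRY, ∃-packaged from `HostBoundary₃`**: a STEP-B host state whose boundary members have irreducible
supports, none inside the host (SUPPORT form of «no host component inside the boundary»), with the host's zero-scheme regular and the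
host reduced (`D = 𝓘(Supp D)`). [cite: CossartJannsenSaito2020, Thm. 1.4] -/
theorem exists_hostState_of_hostBoundary₃ [IsNoetherian E] {H : E.IdealSheafData} (h : HostBoundary₃ E H) :
    ∃ (D : E.IdealSheafData) (ℬ : List (E.IdealSheafData × ℕ)), HostState H D ℬ ∧
      (∀ p ∈ ℬ, IsIrreducible (p.1.support : Set E) ∧ ¬ ((p.1.support : Set E) ⊆ D.support)) ∧
      Scheme.IsRegular D.subscheme ∧ D = vanishingIdeal D.support := by
  obtain ⟨D, ℬ, S, hreg⟩ := h
  exact ⟨D, ℬ, HostState.of_stateIn S hreg, fun p hp => ⟨S.irred p hp, S.free p hp⟩, hreg, S.hostRad⟩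

/-- [OURS · L1 W5.2] **IDEAL form of «no host component inside the boundary»** for the entry state: no boundary member contains
the host (`¬ D ≤ B`), and — both being prime divisors is not needed for this direction — no boundary member's support lies in the
host's. [folklore] -/
theorem not_host_le_of_hostBoundary₃ [IsNoetherian E] {H D : E.IdealSheafData} {ℬ : List (E.IdealSheafData × ℕ)}
    (S : WeightTwoB.StateIn H D ℬ []) (p : E.IdealSheafData × ℕ) (hp : p ∈ ℬ) : ¬ D ≤ p.1 :=
  S.not_host_le p hp

end DepthLegal

end Summit.ResolutionOfSingularities.ResolutionOfSingularities.Theorems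

end
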